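import Summits.SmoothPoincare4.SmoothPoincare4.Theorems.ConvexBisectionAcyclicBisectionExistsDualHandleSeamModelChart
import HarnessLib

/-!
# Dual handles, VII: the dual attaching map read in the model chart
(brick (ii-c) of the sub-goal T3b "the complement of the prefix sub-handlebody is the other piece
with the DUAL suffix handles" of stub `stub_steinRealisation` (NF6), line `modp-braid-orbits` r11,
crux `ConvexBisection.AcyclicBisectionExists`, item stmt-SmoothPoincare4-10508; wave 2, lead c5)

Sequel of `…DualHandleSeamModelChart.lean` (the model chart `modelChart D j G a : ℝ⁴ → M'` of
Milnor's gluing `M' = X ∪_Ψ W` around the `j`-th belt circle, equal to the handle chart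
`jM ∘ D.jB j` on the `X`-side and to the collar of `W` on the `W`-side).  Here the dual attaching
map `dualMap D bX bW Ψ col κ δ j : T → W` of the `j`-th handle (`…DualHandlePlumbing.lean`: the belt
tube pushed through the seam diffeomorphism and prolonged along a collar `col` of `∂W`) is read in
that chart:

* `gProfile a t = a t / (2 (1 - t))`, `dualVec a κ δ y = (κ x_μ(y), R x̂_λ(y))` with
  `R² = 1 + gProfile a (δ d) - κ² ‖x_μ(y)‖²`, `d = 1 - ‖y‖²` (`lamPart_dualVec`, `muDir_dualVec`,
  `norm_dualVec_sq : ‖dualVec‖² = 1 + gProfile a (δ d)`, `seamHeight_dualVec`);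
* **`jN_dualMap_eq_modelChart`**: for `col` matched with the open collar `G.CN` of the gluing
  (`col (w, t) = G.CN x (t/(2-t))`, `exists_openCollar_collar_eq`),
  `jN (dualMap … j y) = modelChart D j G a (dualVec a κ δ y)` for all `y ∈ T`;
* `helper_jN_dualMap_eq_modelChart` (registered).

With `…SeamModelChart.lean` this puts the `X`-side handle, the `W`-side collar AND the dual
attaching map of the `j`-th handle into one explicit smooth chart of `ℝ⁴`, in which the long pole
of T3b (the multi-attachment data of `W₂` along the dual maps) becomes a computation with explicit
formulas.  Everything here is proved; no named facts.

## References
* J. Milnor, *Lectures on the h-cobordism theorem* (1965), Thm. 1.4, §3. [MilnorHCobordism1965]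
* A. A. Kosinski, *Differential Manifolds* (1993), III §4, VI §6. [Kosinski1993]
-/

noncomputable section

-- the prescribed namespace `Summit.<P>.<Sub>.…` duplicates `SmoothPoincare4` (P = Sub)
set_option linter.dupNamespace false

open scoped Manifold ContDiff Topology

namespace Summit.SmoothPoincare4.SmoothPoincare4.Theorems.AcyclicBisectionExists.ModpBraidOrbits

open Set Function Metric
open Literature.Topology.FourManifolds Literature.Topology.FourManifolds.HandleAttachingMap

/-! ### §3 The dual attaching map read in the model chart -/

section Dual

variable {B : Type} [TopologicalSpace B] [T2Space B] [ChartedSpace (EuclideanHalfSpace 4) B]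
  {ι : Type} [Finite ι] {h : ι → HandleAttachingMap 3 2 B}
  {X : Type} [TopologicalSpace X] [ChartedSpace (EuclideanHalfSpace 4) X] [IsManifold (𝓡∂ 4) ∞ X]
  (D : MultiAttachmentData h (𝓡∂ 4) X) (j : ι) {bX : BoundaryData (𝓡∂ 4) X (𝓡 3)}
  {W : Type} [TopologicalSpace W] [ChartedSpace (EuclideanHalfSpace 4) W]
  [IsManifold (𝓡∂ 4) ∞ W] {bW : BoundaryData (𝓡∂ 4) W (𝓡 3)}

/-- The `W`-depth profile of the model chart: `g a t = a t / (2 (1 - t))`, the value of `‖x‖² - 1`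
at the collar point of height `t` of the matched collar `col`. [folklore] -/
def gProfile (a t : ℝ) : ℝ := a * t / (2 * (1 - t))

/-- `g a t ≥ 0` for `0 ≤ a`, `0 ≤ t < 1`. [folklore] -/
theorem gProfile_nonneg {a t : ℝ} (ha : 0 ≤ a) (ht : 0 ≤ t) (ht1 : t < 1) : 0 ≤ gProfile a t :=
  div_nonneg (mul_nonneg ha ht) (by linarith)

/-- **The dual vector**: `dualVec a κ δ y = (κ x_μ(y), R x̂_λ(y))` with
`R² = 1 + g a (δ d) - κ² ‖x_μ(y)‖²`, `d = 1 - ‖y‖²` — the model coordinates of the dual attaching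
map at `y ∈ T` (`jN_dualMap_eq_modelChart`). [cite: MilnorHCobordism1965, §3] -/
def dualVec (a κ δ : ℝ) (y : ↥(handleTube 3 2)) : EuclideanSpace ℝ (Fin 4) :=
  lamEmbed (κ • tubeFibre y) +
    Real.sqrt (1 + gProfile a (δ * tubeDepth y) - κ ^ 2 * ‖tubeFibre y‖ ^ 2) •
      muEmbed (tubeAngle y : EuclideanSpace ℝ (Fin 2))

/-- `δ d ∈ [0, 1)` on the tube. [folklore] -/
theorem mul_tubeDepth_lt_one {δ : ℝ} (hδ : 0 < δ) (hδ2 : δ ≤ 1 / 2) (y : ↥(handleTube 3 2)) :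
    0 ≤ δ * tubeDepth y ∧ δ * tubeDepth y < 1 := by
  refine ⟨mul_nonneg hδ.le (tubeDepth_nonneg y), ?_⟩
  have := tubeDepth_lt_one y
  nlinarith [tubeDepth_nonneg y]

/-- The radicand of `R` is positive. [folklore] -/
theorem dualVec_radicand_pos {a κ δ : ℝ} (ha : 0 < a) (hκ : 0 < κ) (hκ1 : κ ≤ 1) (hδ : 0 < δ)
    (hδ2 : δ ≤ 1 / 2) (y : ↥(handleTube 3 2)) :
    0 < 1 + gProfile a (δ * tubeDepth y) - κ ^ 2 * ‖tubeFibre y‖ ^ 2 := by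
  have h1 := gProfile_nonneg ha.le (mul_tubeDepth_lt_one hδ hδ2 y).1 (mul_tubeDepth_lt_one hδ hδ2 y).2
  have h2 : ‖tubeFibre y‖ ^ 2 < 1 := by
    have := norm_tubeFibre_lt_one y
    nlinarith [norm_nonneg (tubeFibre y)]
  have h3 : κ ^ 2 ≤ 1 := by nlinarith
  nlinarith [sq_nonneg κ]

/-- `λ`-part of the dual vector: `κ x_μ(y)`. [folklore] -/
theorem lamPart_dualVec (a κ δ : ℝ) (y : ↥(handleTube 3 2)) : lamPart (dualVec a κ δ y) = κ • tubeFibre y := by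
  rw [dualVec, lamPart_add, lamPart_lamEmbed, lamPart_smul, lamPart_muEmbed, smul_zero, add_zero]

/-- `μ`-part of the dual vector: `R x̂_λ(y)`. [folklore] -/
theorem muPart_dualVec (a κ δ : ℝ) (y : ↥(handleTube 3 2)) :
    muPart (dualVec a κ δ y) =
      Real.sqrt (1 + gProfile a (δ * tubeDepth y) - κ ^ 2 * ‖tubeFibre y‖ ^ 2) •
        (tubeAngle y : EuclideanSpace ℝ (Fin 2)) := by
  rw [dualVec, muPart_add, muPart_lamEmbed, muPart_smul, muPart_muEmbed, zero_add]

/-- The `μ`-part of the dual vector is non-zero. [folklore] -/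
theorem muPart_dualVec_ne_zero {a κ δ : ℝ} (ha : 0 < a) (hκ : 0 < κ) (hκ1 : κ ≤ 1) (hδ : 0 < δ)
    (hδ2 : δ ≤ 1 / 2) (y : ↥(handleTube 3 2)) : muPart (dualVec a κ δ y) ≠ 0 := by
  rw [muPart_dualVec, smul_ne_zero_iff]
  refine ⟨(Real.sqrt_pos.2 (dualVec_radicand_pos ha hκ hκ1 hδ hδ2 y)).ne', ?_⟩
  intro h0
  have := norm_eq_of_mem_sphere (tubeAngle y)
  rw [h0, norm_zero] at this
  exact zero_ne_one this

/-- **The `μ`-direction of the dual vector is the angle `x̂_λ(y)`.** [folklore] -/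
theorem muDir_dualVec {a κ δ : ℝ} (ha : 0 < a) (hκ : 0 < κ) (hκ1 : κ ≤ 1) (hδ : 0 < δ)
    (hδ2 : δ ≤ 1 / 2) (y : ↥(handleTube 3 2)) : muDir (dualVec a κ δ y) = tubeAngle y := by
  apply Subtype.ext
  have hR := Real.sqrt_pos.2 (dualVec_radicand_pos ha hκ hκ1 hδ hδ2 y)
  rw [coe_muDir (muPart_dualVec_ne_zero ha hκ hκ1 hδ hδ2 y), muPart_dualVec, norm_smul,
    Real.norm_of_nonneg hR.le, norm_eq_of_mem_sphere (tubeAngle y), mul_one, smul_smul,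
    inv_mul_cancel₀ hR.ne', one_smul]

/-- **`‖dualVec‖² = 1 + g a (δ d)`**: the dual attaching map lands at `W`-depth `g a (δ d)`.
[folklore] -/
theorem norm_dualVec_sq {a κ δ : ℝ} (ha : 0 < a) (hκ : 0 < κ) (hκ1 : κ ≤ 1) (hδ : 0 < δ)
    (hδ2 : δ ≤ 1 / 2) (y : ↥(handleTube 3 2)) :
    ‖dualVec a κ δ y‖ ^ 2 = 1 + gProfile a (δ * tubeDepth y) := by
  have hR := (dualVec_radicand_pos ha hκ hκ1 hδ hδ2 y).le
  rw [dualVec, ← muEmbed_smul, norm_lamEmbed_add_muEmbed_sq, norm_smul, norm_smul,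
    Real.norm_of_nonneg (Real.sqrt_nonneg _), norm_eq_of_mem_sphere (tubeAngle y), mul_one,
    Real.sq_sqrt hR, mul_pow, Real.norm_of_nonneg hκ.le]
  ring

/-- **The seam height of the dual vector**: `-(t / (2 - t))`, `t = δ d`. [folklore] -/
theorem seamHeight_dualVec {a κ δ : ℝ} (ha : 0 < a) (hκ : 0 < κ) (hκ1 : κ ≤ 1) (hδ : 0 < δ)
    (hδ2 : δ ≤ 1 / 2) (y : ↥(handleTube 3 2)) :
    seamHeight a (dualVec a κ δ y) = -(δ * tubeDepth y / (2 - δ * tubeDepth y)) := by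
  obtain ⟨ht0, ht1⟩ := mul_tubeDepth_lt_one hδ hδ2 y
  rw [seamHeight, norm_dualVec_sq ha hκ hκ1 hδ hδ2, gProfile]
  have h2 : (1 : ℝ) - δ * tubeDepth y ≠ 0 := by intro h; linarith
  have h3 : (2 : ℝ) - δ * tubeDepth y ≠ 0 := by intro h; linarith
  have hden : a - 1 + (1 + a * (δ * tubeDepth y) / (2 * (1 - δ * tubeDepth y))) =
      a * (2 - δ * tubeDepth y) / (2 * (1 - δ * tubeDepth y)) := by
    field_simp
    ring
  have hnum : 1 - (1 + a * (δ * tubeDepth y) / (2 * (1 - δ * tubeDepth y))) =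
      -(a * (δ * tubeDepth y)) / (2 * (1 - δ * tubeDepth y)) := by
    field_simp
    ring
  rw [hnum, hden, div_div_div_cancel_right₀ (by positivity : (2 : ℝ) * (1 - δ * tubeDepth y) ≠ 0),
    neg_div, mul_div_mul_left _ _ ha.ne']

/-- `1 - ‖dualVec‖² < a`. [folklore] -/
theorem one_sub_norm_dualVec_sq_lt {a κ δ : ℝ} (ha : 0 < a) (hκ : 0 < κ) (hκ1 : κ ≤ 1) (hδ : 0 < δ)
    (hδ2 : δ ≤ 1 / 2) (y : ↥(handleTube 3 2)) : 1 - ‖dualVec a κ δ y‖ ^ 2 < a := by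
  rw [norm_dualVec_sq ha hκ hκ1 hδ hδ2]
  have := gProfile_nonneg ha.le (mul_tubeDepth_lt_one hδ hδ2 y).1 (mul_tubeDepth_lt_one hδ hδ2 y).2
  linarith

/-- `1 ≤ ‖dualVec‖`. [folklore] -/
theorem one_le_norm_dualVec {a κ δ : ℝ} (ha : 0 < a) (hκ : 0 < κ) (hκ1 : κ ≤ 1) (hδ : 0 < δ)
    (hδ2 : δ ≤ 1 / 2) (y : ↥(handleTube 3 2)) : 1 ≤ ‖dualVec a κ δ y‖ := by
  have h1 : 1 ≤ ‖dualVec a κ δ y‖ ^ 2 := by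
    rw [norm_dualVec_sq ha hκ hκ1 hδ hδ2]
    have := gProfile_nonneg ha.le (mul_tubeDepth_lt_one hδ hδ2 y).1 (mul_tubeDepth_lt_one hδ hδ2 y).2
    linarith
  nlinarith [norm_nonneg (dualVec a κ δ y)]

/-- `‖lamPart dualVec‖ < κ`. [folklore] -/
theorem norm_lamPart_dualVec_lt {a κ δ : ℝ} (hκ : 0 < κ) (y : ↥(handleTube 3 2)) :
    ‖lamPart (dualVec a κ δ y)‖ < κ := by
  rw [lamPart_dualVec, norm_smul, Real.norm_of_nonneg hκ.le]
  have := norm_tubeFibre_lt_one y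
  nlinarith

/-- The seam point under the dual vector is the belt-tube point `(x̂_λ(y), κ x_μ(y))` (read in `bX`).
[folklore] -/
theorem seamPt_dualVec {a κ δ : ℝ} (ha : 0 < a) (hκ : 0 < κ) (hκ1 : κ ≤ 1) (hδ : 0 < δ)
    (hδ2 : δ ≤ 1 / 2) (y : ↥(handleTube 3 2)) :
    seamPt D j bX (dualVec a κ δ y) =
      (BoundaryManifold.boundaryData 3 X).restrictDiffeomorph bX (Diffeomorph.refl (𝓡∂ 4) X ∞)
        ((beltMap D j).boundaryTube.toHomeo (tubeAngle y, κ • tubeFibre y)) := by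
  rw [seamPt, muDir_dualVec ha hκ hκ1 hδ hδ2, lamPart_dualVec]

variable [Nonempty bX.carrier]

/-- **THE DUAL ATTACHING MAP READ IN THE MODEL CHART.**  Let `col` be a collar of the canonical
boundary datum of `W` matched with the open collar `G.CN` (`exists_openCollar_collar_eq`:
`col (w, t) = G.CN x (t/(2-t))` when `incl w = bW.incl x`).  Then for every `y ∈ T`,
`jN (dualMap D bX bW Ψ col κ δ j y) = modelChart (dualVec a κ δ y)`: the dual attaching map of the
`j`-th handle (the belt tube pushed through the seam and prolonged along `col`) is, in the model
chart, the explicit vector `(κ x_μ(y), R x̂_λ(y))`. [cite: MilnorHCobordism1965, §3] -/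
theorem jN_dualMap_eq_modelChart (G : BoundaryGlueData bX bW) {a κ δ : ℝ} (ha : 0 < a) (hκ : 0 < κ)
    (hκ1 : κ ≤ 1) (hδ : 0 < δ) (hδ2 : δ ≤ 1 / 2)
    (col : (BoundaryManifold.boundaryData 3 W).Collar)
    (hcol : ∀ (w : (BoundaryManifold.boundaryData 3 W).carrier) (x : bW.carrier),
      (BoundaryManifold.boundaryData 3 W).incl w = bW.incl x →
      ∀ t : Set.Icc (0 : ℝ) 1, col.toFun (w, t) = G.CN.toFun x ((t : ℝ) / (2 - t)))
    (y : ↥(handleTube 3 2)) :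
    G.jN ((dualMap D bX bW G.φ col κ δ hκ hκ1 hδ hδ2 j).toFun y) = modelChart D j G a (dualVec a κ δ y) := by
  obtain ⟨ht0, ht1⟩ := mul_tubeDepth_lt_one hδ hδ2 y
  have htv : ((Set.projIcc 0 1 zero_le_one (δ * tubeDepth y) : Set.Icc (0 : ℝ) 1) : ℝ) = δ * tubeDepth y :=
    congrArg Subtype.val (Set.projIcc_of_mem zero_le_one (a := (0:ℝ)) (b := 1)
      ⟨ht0, by linarith [hδ2, tubeDepth_lt_one y, tubeDepth_nonneg y]⟩)
  -- the left-hand side: `col` at the pushed tube point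
  have hL : (dualMap D bX bW G.φ col κ δ hκ hκ1 hδ hδ2 j).toFun y =
      col.toFun (seamDiffeo bX bW G.φ ((beltMap D j).boundaryTube.toHomeo (tubeAngle y, κ • tubeFibre y)),
        Set.projIcc 0 1 zero_le_one (δ * tubeDepth y)) := by
    rw [dualMap, pushedMap, TubeAttachData.attachingMap_apply]
    show col.toFun (((beltMap D j).boundaryTube.mapDiffeo (seamDiffeo bX bW G.φ)).toHomeo
      (tubeAngle y, κ • tubeFibre y), _) = _
    rw [CircleTube.mapDiffeo_apply]
    rfl
  have hs : 0 ≤ ((Set.projIcc 0 1 zero_le_one (δ * tubeDepth y) : Set.Icc (0 : ℝ) 1) : ℝ) /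
      (2 - ((Set.projIcc 0 1 zero_le_one (δ * tubeDepth y) : Set.Icc (0 : ℝ) 1) : ℝ)) := by
    rw [htv]; exact div_nonneg ht0 (by linarith)
  rw [hL, hcol _ _ (coe_seamDiffeo bX bW G.φ _), G.jN_toFun _ hs, modelChart,
    seamPt_dualVec D j ha hκ hκ1 hδ hδ2, seamHeight_dualVec ha hκ hκ1 hδ hδ2, htv]

/-- **Registered helper `helper_jN_dualMap_eq_modelChart` (brick (ii-c) of T3b, sub-goal of NF6
`stub_steinRealisation`, wave 2, lead c5): the dual attaching map of the `j`-th handle read in the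
model chart of Milnor's gluing is the explicit vector `dualVec a κ δ y`.**
[cite: MilnorHCobordism1965, §3] -/
theorem helper_jN_dualMap_eq_modelChart : ∀ {B : Type} [TopologicalSpace B] [T2Space B] [ChartedSpace (EuclideanHalfSpace 4) B] {ι : Type} [Finite ι] {h : ι → Literature.Topology.FourManifolds.HandleAttachingMap 3 2 B} {X : Type} [TopologicalSpace X] [ChartedSpace (EuclideanHalfSpace 4) X] [IsManifold (𝓡∂ 4) ∞ X] (D : Literature.Topology.FourManifolds.HandleAttachingMap.MultiAttachmentData h (𝓡∂ 4) X) (j : ι) {bX : Literature.Topology.FourManifolds.BoundaryData (𝓡∂ 4) X (𝓡 3)} {W : Type} [TopologicalSpace W] [ChartedSpace (EuclideanHalfSpace 4) W] [IsManifold (𝓡∂ 4) ∞ W] {bW : Literature.Topology.FourManifolds.BoundaryData (𝓡∂ 4) W (𝓡 3)} [Nonempty bX.carrier] (G : Literature.Topology.FourManifolds.BoundaryGlueData bX bW) {a κ δ : ℝ} (ha : 0 < a) (hκ : 0 < κ) (hκ1 : κ ≤ 1) (hδ : 0 < δ) (hδ2 : δ ≤ 1 / 2) (col : (Literature.Topology.FourManifolds.BoundaryManifold.boundaryData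 3 W).Collar), (∀ (w : (Literature.Topology.FourManifolds.BoundaryManifold.boundaryData 3 W).carrier) (x : bW.carrier), (Literature.Topology.FourManifolds.BoundaryManifold.boundaryData 3 W).incl w = bW.incl x → ∀ t : Set.Icc (0 : ℝ) 1, col.toFun (w, t) = G.CN.toFun x ((t : ℝ) / (2 - t))) → ∀ y : ↥(Literature.Topology.FourManifolds.handleTube 3 2), G.jN ((Summit.SmoothPoincare4.SmoothPoincare4.Theorems.AcyclicBisectionExists.ModpBraidOrbits.dualMap D bX bW G.φ col κ δ hκ hκ1 hδ hδ2 j).toFun y) = Summit.SmoothPoincare4.SmoothPoincare4.Theorems.AcyclicBisectionExists.ModpBraidOrbits.modelChart D j G a (Summit.SmoothPoincare4.SmoothPoincare4.Theorems.AcyclicBisectionExists.ModpBraidOrbits.dualVec a κ δ y) :=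
  fun D j _ _ _ _ _ _ _ G _ _ _ ha hκ hκ1 hδ hδ2 col hcol y =>
    jN_dualMap_eq_modelChart D j G ha hκ hκ1 hδ hδ2 col hcol y

end Dual

end Summit.SmoothPoincare4.SmoothPoincare4.Theorems.AcyclicBisectionExists.ModpBraidOrbits

end
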